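import Mathlib
import Summits.ValiantsHypothesis.ValiantsHypothesis.Theorems.ProofCarryingSymmetryRestorationQPPCDeadWeight
import Summits.ValiantsHypothesis.ValiantsHypothesis.Theorems.ProofCarryingSymmetryRestorationQPACLayoutSem

/-!
# Route ProofCarryingSymmetry — crux `RestorationQP`, line `registered`: circuits with the same unfolding are `P_c`-interderivable in polynomial size

Hrubeš–Tzameret, arXiv:1112.6265 Remark 1.3 ("A1, C1, C2 may be replaced by the scheme A1′:
`F = G` whenever `F• = G•`; A1′ is polynomially derivable"), for the TREE's straight-line rendering
of `P_c` (`Literature.…PIProof`, where it is listed as not yet formalised).  Two facts: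

* `hasPCProofOfSize_of_unfold_eq` — over a commutative RING of constants, two `PICircuit`s with
  the same unfolding are interderivable in `P_c` by ONE proof DAG of size
  `≤ 500·M·(|C₁|+1)(|C₂|+1) + 4M`, `M = 3(|C₁|+|C₂|) + 7` (pairs of prefixes with equal unfoldings,
  bottom-up; leaves and junk references by dead-weight elimination, gates by C1/C2 unsharing and
  congruence — the proof-DAG toolkit of the necessity programme, parts 1 and 3);
* the caveat, recorded in part 3: WITHOUT A6–A10 this fails (dead weight is rigid in the AC
  fragment: `⟨[x], 5⟩` and `⟨[], 5⟩` unfold alike but are not AC-interderivable), so Remark 1.3 holds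
  for the tree's presentations only with the full axiom set — sizes are faithful to HT's DAG model up
  to this polynomial, axiom-metered budgets are not (which is why the line's stability pair is typed
  over unfoldings).

Consequence for stub T′ (`stub_invarianceProvableQP'`): its conclusion (short `P_c` proofs of the
invariance identities of SOME circuit for `f n`) does not depend on the straight-line presentation of
that circuit, up to a polynomial (`hasPCProofOfSize_rename_of_unfold_eq`).  Everything proved.
-/

-- single-problem summit: `Summit.ValiantsHypothesis.ValiantsHypothesis.…` is the namespace by design (D-0017)
set_option linter.dupNamespace false

namespace Summit.ValiantsHypothesis.ValiantsHypothesis.Theorems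

namespace PCR

open Literature.Computability.AlgebraicComplexity PICircuit

universe u v

variable {𝔽 : Type u} {X : Type v}

/-! ### Unfoldings of prefixes -/

section Unfold

variable [Zero 𝔽]

/-- A circuit is the prefix of its node list at the position of its output node. [folklore] -/
theorem pre_nodes (C : PICircuit 𝔽 X) : pre C.nodes C.body.length = C := by
  cases C with
  | mk body out => simp [pre, PICircuit.nodes]

/-- The unfolding of a prefix past the end is the junk leaf `0`. [folklore] -/
theorem unfold_pre_of_le (B : List (Node 𝔽 X)) {i : ℕ} (hi : B.length ≤ i) : (pre B i).unfold = .const 0 := by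
  have h := getD_unfoldList_eq_unfold_prefixAt B (.const 0) i
  rw [prefixAt_eq_pre] at h
  rw [← h, List.getD_eq_default _ _ (by simpa using hi)]

/-- The unfolding of a prefix is the unfolding of its node over the earlier prefix. [folklore] -/
theorem unfold_pre_eq (B : List (Node 𝔽 X)) (i : ℕ) :
    (pre B i).unfold = (B.getD i (.const 0)).unfold (unfoldList [] (B.take i)) := by
  have h := getD_unfoldList_eq_unfold_prefixAt B (.const 0) i
  rw [prefixAt_eq_pre] at h
  rw [← h]
  exact ACStability.getD_unfoldList_eq B i

/-- Child prefixes: the unfolding of `pre (B.take i) a` is entry `a` of the unfolding list of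
`B.take i`. [folklore] -/
theorem unfold_pre_take (B : List (Node 𝔽 X)) (i a : ℕ) :
    (pre (B.take i) a).unfold = (unfoldList [] (B.take i)).getD a (.const 0) := by
  have h := getD_unfoldList_eq_unfold_prefixAt (B.take i) (.const 0) a
  rw [prefixAt_eq_pre] at h
  exact h.symm

/-- A prefix unfolding to a variable leaf ends in that variable leaf, inside the body. [folklore] -/
theorem node_of_unfold_var (B : List (Node 𝔽 X)) {i : ℕ} {x : X} (h : (pre B i).unfold = .var x) :
    i < B.length ∧ B.getD i (.const 0) = .var x := by
  rcases lt_or_ge i B.length with hi | hi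
  · refine ⟨hi, ?_⟩
    rw [unfold_pre_eq B i] at h
    cases hn : B.getD i (.const 0) <;> rw [hn] at h <;> simp [Node.unfold] at h ⊢
    exact h
  · rw [unfold_pre_of_le B hi] at h; simp at h

/-- A prefix unfolding to a constant leaf ends in that constant leaf or lies past the end (junk
`0`). [folklore] -/
theorem node_of_unfold_const (B : List (Node 𝔽 X)) {i : ℕ} {c : 𝔽} (h : (pre B i).unfold = .const c) :
    (i < B.length ∧ B.getD i (.const 0) = .const c) ∨ (B.length ≤ i ∧ c = 0) := by
  rcases lt_or_ge i B.length with hi | hi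
  · refine Or.inl ⟨hi, ?_⟩
    rw [unfold_pre_eq B i] at h
    cases hn : B.getD i (.const 0) <;> rw [hn] at h <;> simp [Node.unfold] at h ⊢
    exact h
  · rw [unfold_pre_of_le B hi] at h
    simp at h
    exact Or.inr ⟨hi, h.symm⟩

/-- A prefix unfolding to a sum ends in a `+` gate inside the body, whose child prefixes unfold
to the two summands. [folklore] -/
theorem node_of_unfold_add (B : List (Node 𝔽 X)) {i : ℕ} {φ ψ : PIFormula 𝔽 X}
    (h : (pre B i).unfold = .add φ ψ) :
    ∃ a b, i < B.length ∧ B.getD i (.const 0) = .add a b ∧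
      (pre (B.take i) a).unfold = φ ∧ (pre (B.take i) b).unfold = ψ := by
  rcases lt_or_ge i B.length with hi | hi
  · rw [unfold_pre_eq B i] at h
    cases hn : B.getD i (.const 0) with
    | var x => rw [hn] at h; simp [Node.unfold] at h
    | const c => rw [hn] at h; simp [Node.unfold] at h
    | add a b =>
      rw [hn] at h
      simp only [Node.unfold, PIFormula.add.injEq] at h
      exact ⟨a, b, hi, rfl, by rw [unfold_pre_take]; exact h.1, by rw [unfold_pre_take]; exact h.2⟩
    | mul a b => rw [hn] at h; simp [Node.unfold] at h
  · rw [unfold_pre_of_le B hi] at h; simp at h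

/-- A prefix unfolding to a product ends in a `×` gate inside the body, whose child prefixes
unfold to the two factors. [folklore] -/
theorem node_of_unfold_mul (B : List (Node 𝔽 X)) {i : ℕ} {φ ψ : PIFormula 𝔽 X}
    (h : (pre B i).unfold = .mul φ ψ) :
    ∃ a b, i < B.length ∧ B.getD i (.const 0) = .mul a b ∧
      (pre (B.take i) a).unfold = φ ∧ (pre (B.take i) b).unfold = ψ := by
  rcases lt_or_ge i B.length with hi | hi
  · rw [unfold_pre_eq B i] at h
    cases hn : B.getD i (.const 0) with
    | var x => rw [hn] at h; simp [Node.unfold] at h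
    | const c => rw [hn] at h; simp [Node.unfold] at h
    | add a b => rw [hn] at h; simp [Node.unfold] at h
    | mul a b =>
      rw [hn] at h
      simp only [Node.unfold, PIFormula.mul.injEq] at h
      exact ⟨a, b, hi, rfl, by rw [unfold_pre_take]; exact h.1, by rw [unfold_pre_take]; exact h.2⟩
  · rw [unfold_pre_of_le B hi] at h; simp at h

/-- Child prefixes at earlier positions are prefixes of the whole body. [folklore] -/
theorem pre_take_of_lt (B : List (Node 𝔽 X)) {i a : ℕ} (ha : a < i) : pre (B.take i) a = pre B a := by
  simp only [pre, List.take_take, min_eq_left ha.le, PICircuit.mk.injEq, true_and]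
  exact getD_take_of_lt B ha

/-- A child prefix unfolding to a non-leaf formula is at an earlier position. [folklore] -/
theorem lt_of_unfold_pre_take (B : List (Node 𝔽 X)) {i a : ℕ}
    (h : ∀ c : 𝔽, (pre (B.take i) a).unfold ≠ .const c) : a < i := by
  by_contra hle
  have : (B.take i).length ≤ a := by simp; omega
  exact h 0 (unfold_pre_of_le (B.take i) this)

/-- The raw C1 instance at a `+` gate: `F_i = F'_a + F'_b` with the child prefixes taken in
`B.take i` (no condition on the child indices — junk references included). [folklore] -/
theorem isExtra_pre_add_take {B : List (Node 𝔽 X)} {i a b : ℕ} (hn : B.getD i (.const 0) = .add a b) :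
    IsExtra .C1 (pre B i) (PICircuit.add (pre (B.take i) a) (pre (B.take i) b)) := by
  have h := IsExtra.c1 (𝔽 := 𝔽) (B.take i) a b
  have e : (⟨B.take i, .add a b⟩ : PICircuit 𝔽 X) = pre B i := by rw [pre, hn]
  rw [e] at h
  exact h

/-- The raw C2 instance at a `×` gate. [folklore] -/
theorem isExtra_pre_mul_take {B : List (Node 𝔽 X)} {i a b : ℕ} (hn : B.getD i (.const 0) = .mul a b) :
    IsExtra .C2 (pre B i) (PICircuit.mul (pre (B.take i) a) (pre (B.take i) b)) := by
  have h := IsExtra.c2 (𝔽 := 𝔽) (B.take i) a b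
  have e : (⟨B.take i, .mul a b⟩ : PICircuit 𝔽 X) = pre B i := by rw [pre, hn]
  rw [e] at h
  exact h

end Unfold

/-! ### Leaf lines -/

section Ring

variable [CommRing 𝔽]

/-- **A prefix unfolding to a leaf equals the one-node circuit**, realized in `P_c` (dead-weight
elimination; the junk case `F_i = ⟨B, 0⟩` included), cost `≤ 102 M` for `M ≥ 3|B| + 7`.
[folklore] -/
theorem Real.preOfLeaf {L : List (PICircuit 𝔽 X × PICircuit 𝔽 X)} {n : ℕ} (h : Real (pcSystem 𝔽 X) L n)
    (B : List (Node 𝔽 X)) (i : ℕ) {ℓ : Node 𝔽 X} (hleaf : ∀ k, ℓ.shift k = ℓ)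
    (hℓ : (ℓ = .const 0 ∧ B.length ≤ i) ∨ (i < B.length ∧ B.getD i (.const 0) = ℓ))
    {M : ℕ} (hM : 3 * B.length + 7 ≤ M) :
    Real (pcSystem 𝔽 X) ((pre B i, ⟨[], ℓ⟩) :: L) (n + 102 * M) := by
  -- reduce to a position `i' ≤ |B|` with `pre B i = pre B i'` and `B.getD i' 0 = ℓ`
  obtain ⟨i', hi', hpre, hget⟩ : ∃ i', i' ≤ B.length ∧ pre B i = pre B i' ∧ B.getD i' (.const 0) = ℓ := by
    rcases hℓ with ⟨rfl, hle⟩ | ⟨hlt, hget⟩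
    · refine ⟨B.length, le_rfl, ?_, List.getD_eq_default _ _ le_rfl⟩
      simp only [pre, List.take_of_length_le hle, List.take_length, List.getD_eq_default _ _ hle,
        List.getD_eq_default _ _ (le_refl B.length)]
    · exact ⟨i, hlt.le, rfl, hget⟩
  rw [hpre]
  rcases Nat.eq_zero_or_pos i' with rfl | hpos
  · -- position 0: the prefix is already the one-node circuit
    have e : pre B 0 = ⟨[], ℓ⟩ := by simp only [pre, List.take_zero, hget]
    rw [e]
    have s : (pcSystem 𝔽 X).size (⟨[], ℓ⟩ : PICircuit 𝔽 X) ≤ M := by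
      simp only [pcSystem, PICircuit.size, List.length_nil]; omega
    exact (h.reflB _ s).mono (List.Subset.refl _) (by omega)
  · have r := h.preLeaf B hpos hi' (fun k => by rw [hget]; exact hleaf k) hM
    rw [hget] at r
    exact r.mono (List.Subset.refl _) (by omega)

/-- **Two prefixes (of two bodies) unfolding to the same LEAF are interderivable**, cost `≤ 210 M`
for `M ≥ 3 max(|B₁|,|B₂|) + 7`. [folklore] -/
theorem Real.leafPair {L : List (PICircuit 𝔽 X × PICircuit 𝔽 X)} {n : ℕ} (h : Real (pcSystem 𝔽 X) L n)
    (B₁ B₂ : List (Node 𝔽 X)) (i j : ℕ) {φ : PIFormula 𝔽 X}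
    (h₁ : (pre B₁ i).unfold = φ) (h₂ : (pre B₂ j).unfold = φ)
    (hφ : (∃ x, φ = .var x) ∨ (∃ c, φ = .const c))
    {M : ℕ} (hM₁ : 3 * B₁.length + 7 ≤ M) (hM₂ : 3 * B₂.length + 7 ≤ M) :
    Real (pcSystem 𝔽 X) ((pre B₁ i, pre B₂ j) :: L) (n + 210 * M) := by
  -- the common leaf node
  obtain ⟨ℓ, hleaf, hℓ₁, hℓ₂⟩ : ∃ ℓ : Node 𝔽 X, (∀ k, ℓ.shift k = ℓ) ∧
      ((ℓ = .const 0 ∧ B₁.length ≤ i) ∨ (i < B₁.length ∧ B₁.getD i (.const 0) = ℓ)) ∧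
      ((ℓ = .const 0 ∧ B₂.length ≤ j) ∨ (j < B₂.length ∧ B₂.getD j (.const 0) = ℓ)) := by
    rcases hφ with ⟨x, rfl⟩ | ⟨c, rfl⟩
    · obtain ⟨hi, hn⟩ := node_of_unfold_var B₁ h₁
      obtain ⟨hj, hm⟩ := node_of_unfold_var B₂ h₂
      exact ⟨.var x, fun _ => rfl, Or.inr ⟨hi, hn⟩, Or.inr ⟨hj, hm⟩⟩
    · refine ⟨.const c, fun _ => rfl, ?_, ?_⟩
      · rcases node_of_unfold_const B₁ h₁ with ⟨hi, hn⟩ | ⟨hi, rfl⟩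
        · exact Or.inr ⟨hi, hn⟩
        · exact Or.inl ⟨rfl, hi⟩
      · rcases node_of_unfold_const B₂ h₂ with ⟨hj, hm⟩ | ⟨hj, rfl⟩
        · exact Or.inr ⟨hj, hm⟩
        · exact Or.inl ⟨rfl, hj⟩
  have r1 := h.preOfLeaf B₁ i hleaf hℓ₁ hM₁
  have r2 := r1.preOfLeaf B₂ j hleaf hℓ₂ hM₂
  have s1 : (pcSystem 𝔽 X).size (pre B₁ i) ≤ M := by have := size_pre_le B₁ i; simp only [pcSystem]; omega
  have s2 : (pcSystem 𝔽 X).size (pre B₂ j) ≤ M := by have := size_pre_le B₂ j; simp only [pcSystem]; omega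
  have s3 : (pcSystem 𝔽 X).size (⟨[], ℓ⟩ : PICircuit 𝔽 X) ≤ M := by
    simp only [pcSystem, PICircuit.size, List.length_nil]; omega
  have r3 := r2.symmB List.mem_cons_self s2 s3
  have r4 := r3.transB (List.mem_cons_of_mem _ (List.mem_cons_of_mem _ List.mem_cons_self)) List.mem_cons_self s1 s2
  refine r4.mono (List.cons_subset_cons _ fun e he => ?_) (by omega)
  exact List.mem_cons_of_mem _ (List.mem_cons_of_mem _ (List.mem_cons_of_mem _ he))

end Ring

end PCR

open Literature.Computability.AlgebraicComplexity in
/-- **Prefixes unfolding to the same leaf are `P_c(ℂ)`-interderivable** (registered helper toward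
stub T′ `stub_invarianceProvableQP'`, crux `RestorationQP`; the leaf case of Hrubeš–Tzameret
Remark 1.3 for the tree's straight-line `P_c`, dead weight and junk references included): cost
`210 M` inside any proof DAG, `M ≥ 3 max(|B₁|,|B₂|) + 7`. [folklore] -/
theorem invarianceProvableQP_aux_leafPair : ∀ (n : ℕ) (L : List (PICircuit ℂ (Fin n × Fin n) × PICircuit ℂ (Fin n × Fin n))) (m : ℕ) (B₁ B₂ : List (PICircuit.Node ℂ (Fin n × Fin n))) (i j M : ℕ) (x : Fin n × Fin n), PCR.Real (pcSystem ℂ (Fin n × Fin n)) L m → (PCR.pre B₁ i).unfold = PIFormula.var x → (PCR.pre B₂ j).unfold = PIFormula.var x → 3 * B₁.length + 7 ≤ M → 3 * B₂.length + 7 ≤ M → PCR.Real (pcSystem ℂ (Fin n × Fin n)) ((PCR.pre B₁ i, PCR.pre B₂ j) :: L) (m + 210 * M) := by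
  intro n L m B₁ B₂ i j M x h h₁ h₂ hM₁ hM₂
  exact h.leafPair B₁ B₂ i j h₁ h₂ (Or.inl ⟨x, rfl⟩) hM₁ hM₂

end Summit.ValiantsHypothesis.ValiantsHypothesis.Theorems
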